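import Literature.Geometry.Lorentzian.KerrLowFrequencyProfiles
import HarnessLib

/-!
# Explicit `r*`-profiles for the near-stationary subrange (DRSR Prop. 8.7.3): the weight
# `ỹ = −exp(−C(R − r₊))`, the `C²` spline `h`, and the unit tent calculus

(family `gr`, infrastructure for statement **gr.S24**; namespace `Literature.Geometry.Lorentzian.Kerr`)

The proof of Proposition 8.7.3 of Dafermos–Rodnianski–Shlapentokh-Rothman (*Decay for solutions
of the wave equation on Kerr exterior spacetimes III*, arXiv:1402.7034 = Ann. of Math. 183 (2016))
uses the weight **`ỹ(r*) = −exp(−C∫_{−∞}^{r*} υ dr*)`** with "`υ = Δ` near `r₊`, `υ = 1` when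
`r* ≥ R*_∞`" (propertiesofp), and a function `h` with "`h = 0` for `r ∈ [r₊, R₁]`,
`h'' = cỹ'ω₀²` for `r ∈ [R₁, R₂]`, `h'' = 0` for `r ∈ [R₂, R₃]`" ((evenmorechoices2)), then taken
back down to `0` ((evenmorechoices3)–(evenmorechoices4)); "Note that one may easily construct an
`h` satisfying …". This file constructs explicit versions:

* **`Kerr.nsWeightY C R x = −exp(−C(R(x) − r₊))`** along a tortoise radius `R`: choosing
  `υ = Δ(R)/(R² + a²) = dR/dr*` makes `∫υ dr* = R − r₊` exact, so `ỹ' = Cυ|ỹ|`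
  (`Kerr.hasDerivAt_nsWeightY`), `−1 < ỹ < 0`, `ỹ → −1` at the horizon, `ỹ → 0` at infinity.
* the **unit tent** `Kerr.unitTent c` (height `1`, support `[c − 1, c + 1]`), its primitive
  `Kerr.unitTentPrim c` (`C¹`, from `0` to `1`) and second primitive `Kerr.unitTentPrim₂ c` (`C²`,
  `= x − c` for `x ≥ c + 1`), via `max(·, 0)`-powers (`Kerr.hasDerivAt_max_zero_cube`);
* **the spline `Kerr.nsSpline κ c₁ c₂ = κ(P₂(·; c₁) − P₂(·; c₂))`**: `C²`, `= 0` for `x ≤ c₁ − 1`,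
  growing with `h'' = κ·tent ≥ 0` on `[c₁ − 1, c₁ + 1]` (the growth zone, to be dominated by
  `ỹ'ω₀²`), **linear `κ(x − c₁)` on `[c₁ + 1, c₂ − 1]`** ("letting `h` grow linearly … we can
  arrange for `h` to be as large as we wish"), bending with `h'' ≤ 0` on `[c₂ − 1, c₂ + 1]` and
  constant `h₃ = κ(c₂ − c₁)` beyond (the take-down to `0` is done later by the logarithmic cut-off
  of `KerrLowFrequencyProfiles`).

No named facts (D-0026); everything is proved.

## References

* M. Dafermos, I. Rodnianski, Y. Shlapentokh-Rothman, arXiv:1402.7034 = Ann. of Math. 183 (2016),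
  §8.7.3, proof of Prop. 8.7.3 ((propertiesofp), (evenmorechoices2)–(evenmorechoices4))
  (key `DafermosRodnianskiShlapentokhrothman2014`).
-/

noncomputable section

open Set Filter Topology

namespace Literature.Geometry.Lorentzian

namespace Kerr

/-! ### `max(·, 0)³` -/

/-- `d/dt max(t, 0)³ = 3 max(t, 0)²` everywhere (`max(t,0)³ = t·max(t,0)²`). [folklore] -/
theorem hasDerivAt_max_zero_cube (t : ℝ) :
    HasDerivAt (fun s : ℝ ↦ max s 0 ^ 3) (3 * max t 0 ^ 2) t := by
  have h := (hasDerivAt_id t).mul (hasDerivAt_max_zero_sq t)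
  have heq : (fun s : ℝ ↦ max s 0 ^ 3) = fun s ↦ id s * max s 0 ^ 2 := by
    funext s
    simp only [id_eq]
    rcases le_or_gt s 0 with hs | hs
    · rw [max_eq_right hs]; ring
    · rw [max_eq_left hs.le]; ring
  rw [heq]
  refine h.congr_deriv ?_
  simp only [id_eq]
  rcases le_or_gt t 0 with ht | ht
  · rw [max_eq_right ht]; ring
  · rw [max_eq_left ht.le]; ring

/-! ### The unit tent and its primitives -/

/-- The **unit tent** centred at `c`: `max(x − c + 1, 0) − 2max(x − c, 0) + max(x − c − 1, 0)`
(height `1` at `c`, support `[c − 1, c + 1]`, slopes `±1`). [folklore] -/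
def unitTent (c x : ℝ) : ℝ :=
  max (x - (c - 1)) 0 - 2 * max (x - c) 0 + max (x - (c + 1)) 0

/-- The **primitive** `∫_{−∞}^x tent` : `(max(·)² − 2max(·)² + max(·)²)/2`, from `0` to `1`.
[folklore] -/
def unitTentPrim (c x : ℝ) : ℝ :=
  (max (x - (c - 1)) 0 ^ 2 - 2 * max (x - c) 0 ^ 2 + max (x - (c + 1)) 0 ^ 2) / 2

/-- The **second primitive** `(max(·)³ − 2max(·)³ + max(·)³)/6`, `= x − c` for `x ≥ c + 1`.
[folklore] -/
def unitTentPrim₂ (c x : ℝ) : ℝ :=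
  (max (x - (c - 1)) 0 ^ 3 - 2 * max (x - c) 0 ^ 3 + max (x - (c + 1)) 0 ^ 3) / 6

section Tent

variable {c : ℝ}

/-- `P₁' = tent`. [folklore] -/
theorem hasDerivAt_unitTentPrim (c x : ℝ) :
    HasDerivAt (unitTentPrim c) (unitTent c x) x := by
  have h1 : HasDerivAt (fun s : ℝ ↦ max (s - (c - 1)) 0 ^ 2) (2 * max (x - (c - 1)) 0) x := by
    have h := (hasDerivAt_max_zero_sq (x - (c - 1))).comp x ((hasDerivAt_id x).sub_const (c - 1))
    simpa [Function.comp_def] using h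
  have h2 : HasDerivAt (fun s : ℝ ↦ max (s - c) 0 ^ 2) (2 * max (x - c) 0) x := by
    have h := (hasDerivAt_max_zero_sq (x - c)).comp x ((hasDerivAt_id x).sub_const c)
    simpa [Function.comp_def] using h
  have h3 : HasDerivAt (fun s : ℝ ↦ max (s - (c + 1)) 0 ^ 2) (2 * max (x - (c + 1)) 0) x := by
    have h := (hasDerivAt_max_zero_sq (x - (c + 1))).comp x ((hasDerivAt_id x).sub_const (c + 1))
    simpa [Function.comp_def] using h
  have h := ((h1.sub (h2.const_mul 2)).add h3).div_const 2
  refine h.congr_deriv ?_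
  unfold unitTent
  ring

/-- `P₂' = P₁`. [folklore] -/
theorem hasDerivAt_unitTentPrim₂ (c x : ℝ) :
    HasDerivAt (unitTentPrim₂ c) (unitTentPrim c x) x := by
  have h1 : HasDerivAt (fun s : ℝ ↦ max (s - (c - 1)) 0 ^ 3) (3 * max (x - (c - 1)) 0 ^ 2) x := by
    have h := (hasDerivAt_max_zero_cube (x - (c - 1))).comp x ((hasDerivAt_id x).sub_const (c - 1))
    simpa [Function.comp_def] using h
  have h2 : HasDerivAt (fun s : ℝ ↦ max (s - c) 0 ^ 3) (3 * max (x - c) 0 ^ 2) x := by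
    have h := (hasDerivAt_max_zero_cube (x - c)).comp x ((hasDerivAt_id x).sub_const c)
    simpa [Function.comp_def] using h
  have h3 : HasDerivAt (fun s : ℝ ↦ max (s - (c + 1)) 0 ^ 3) (3 * max (x - (c + 1)) 0 ^ 2) x := by
    have h := (hasDerivAt_max_zero_cube (x - (c + 1))).comp x ((hasDerivAt_id x).sub_const (c + 1))
    simpa [Function.comp_def] using h
  have h := ((h1.sub (h2.const_mul 2)).add h3).div_const 6
  refine h.congr_deriv ?_
  unfold unitTentPrim
  ring

/-- Values left of the support (`x ≤ c − 1`): `tent = P₁ = P₂ = 0`. [folklore] -/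
theorem unitTent_of_le_left {x : ℝ} (hx : x ≤ c - 1) :
    unitTent c x = 0 ∧ unitTentPrim c x = 0 ∧ unitTentPrim₂ c x = 0 := by
  unfold unitTent unitTentPrim unitTentPrim₂
  rw [max_eq_right (by linarith), max_eq_right (by linarith), max_eq_right (by linarith)]
  norm_num

/-- Values right of the support (`x ≥ c + 1`): `tent = 0`, `P₁ = 1`, `P₂ = x − c`. [folklore] -/
theorem unitTent_of_ge_right {x : ℝ} (hx : c + 1 ≤ x) :
    unitTent c x = 0 ∧ unitTentPrim c x = 1 ∧ unitTentPrim₂ c x = x - c := by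
  unfold unitTent unitTentPrim unitTentPrim₂
  rw [max_eq_left (by linarith), max_eq_left (by linarith), max_eq_left (by linarith)]
  refine ⟨by ring, by ring, by ring⟩

/-- Values on the rising half `[c − 1, c]`: `tent = x − c + 1`, `P₁ = (x − c + 1)²/2`,
`P₂ = (x − c + 1)³/6`. [folklore] -/
theorem unitTent_of_mem_left {x : ℝ} (h1 : c - 1 ≤ x) (h2 : x ≤ c) :
    unitTent c x = x - c + 1 ∧ unitTentPrim c x = (x - c + 1) ^ 2 / 2 ∧
      unitTentPrim₂ c x = (x - c + 1) ^ 3 / 6 := by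
  unfold unitTent unitTentPrim unitTentPrim₂
  rw [max_eq_left (by linarith), max_eq_right (by linarith), max_eq_right (by linarith)]
  refine ⟨by ring, by ring, by ring⟩

/-- Values on the falling half `[c, c + 1]`: `tent = c + 1 − x`,
`P₁ = ((x − c + 1)² − 2(x − c)²)/2`, `P₂ = ((x − c + 1)³ − 2(x − c)³)/6`. [folklore] -/
theorem unitTent_of_mem_right {x : ℝ} (h1 : c ≤ x) (h2 : x ≤ c + 1) :
    unitTent c x = c + 1 - x ∧ unitTentPrim c x = ((x - c + 1) ^ 2 - 2 * (x - c) ^ 2) / 2 ∧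
      unitTentPrim₂ c x = ((x - c + 1) ^ 3 - 2 * (x - c) ^ 3) / 6 := by
  unfold unitTent unitTentPrim unitTentPrim₂
  rw [max_eq_left (by linarith), max_eq_left (by linarith), max_eq_right (by linarith)]
  refine ⟨by ring, by ring, by ring⟩

/-- `0 ≤ tent ≤ 1`. [folklore] -/
theorem unitTent_mem_Icc (c x : ℝ) : unitTent c x ∈ Icc (0 : ℝ) 1 := by
  rcases le_or_gt x (c - 1) with h | h
  · rw [(unitTent_of_le_left h).1]; exact ⟨le_rfl, zero_le_one⟩
  rcases le_or_gt x c with h' | h'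
  · rw [(unitTent_of_mem_left h.le h').1]; constructor <;> linarith
  rcases le_or_gt x (c + 1) with h'' | h''
  · rw [(unitTent_of_mem_right h'.le h'').1]; constructor <;> linarith
  · rw [(unitTent_of_ge_right h''.le).1]; exact ⟨le_rfl, zero_le_one⟩

/-- `0 ≤ P₁ ≤ 1`. [folklore] -/
theorem unitTentPrim_mem_Icc (c x : ℝ) : unitTentPrim c x ∈ Icc (0 : ℝ) 1 := by
  rcases le_or_gt x (c - 1) with h | h
  · rw [(unitTent_of_le_left h).2.1]; exact ⟨le_rfl, zero_le_one⟩
  rcases le_or_gt x c with h' | h'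
  · rw [(unitTent_of_mem_left h.le h').2.1]
    constructor
    · positivity
    · nlinarith
  rcases le_or_gt x (c + 1) with h'' | h''
  · rw [(unitTent_of_mem_right h'.le h'').2.1]
    constructor <;> nlinarith
  · rw [(unitTent_of_ge_right h''.le).2.1]; exact ⟨zero_le_one, le_rfl⟩

/-- `0 ≤ P₂`, and `P₂ ≤ x − c + 1` for `x ≥ c − 1`. [folklore] -/
theorem unitTentPrim₂_bounds (c x : ℝ) :
    0 ≤ unitTentPrim₂ c x ∧ (c - 1 ≤ x → unitTentPrim₂ c x ≤ x - c + 1) := by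
  rcases le_or_gt x (c - 1) with h | h
  · rw [(unitTent_of_le_left h).2.2]; exact ⟨le_rfl, fun _ ↦ by linarith⟩
  rcases le_or_gt x c with h' | h'
  · rw [(unitTent_of_mem_left h.le h').2.2]
    have h0 : 0 ≤ x - c + 1 := by linarith
    have h1 : x - c + 1 ≤ 1 := by linarith
    refine ⟨by positivity, fun _ ↦ ?_⟩
    nlinarith [pow_le_one₀ h0 h1 (n := 2)]
  rcases le_or_gt x (c + 1) with h'' | h''
  · rw [(unitTent_of_mem_right h'.le h'').2.2]
    have h0 : 0 ≤ x - c := by linarith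
    have h1 : x - c ≤ 1 := by linarith
    refine ⟨by nlinarith [pow_le_one₀ h0 h1 (n := 2), mul_nonneg h0 h0], fun _ ↦ ?_⟩
    nlinarith [mul_nonneg h0 h0, pow_le_one₀ h0 h1 (n := 2)]
  · rw [(unitTent_of_ge_right h''.le).2.2]; exact ⟨by linarith, fun _ ↦ by linarith⟩

/-- `P₁` is translation-monotone: for `c₁ ≤ c₂`, `P₁(x; c₂) ≤ P₁(x; c₁)` (`P₁(x;c) = F(x − c)` with
`F` non-decreasing). [folklore] -/
theorem unitTentPrim_anti {c₁ c₂ x : ℝ} (h : c₁ ≤ c₂) : unitTentPrim c₂ x ≤ unitTentPrim c₁ x := by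
  -- `P₁(x; c) = P₁(x − c + c₀; c₀)`: reduce to monotonicity of `P₁(·; c₁)` in `x`
  have hmono : Monotone (unitTentPrim c₁) :=
    monotone_of_hasDerivAt_nonneg (fun x ↦ hasDerivAt_unitTentPrim c₁ x)
      fun x ↦ (unitTent_mem_Icc c₁ x).1
  have heq : unitTentPrim c₂ x = unitTentPrim c₁ (x - (c₂ - c₁)) := by
    unfold unitTentPrim
    have e1 : x - (c₂ - c₁) - (c₁ - 1) = x - (c₂ - 1) := by ring
    have e2 : x - (c₂ - c₁) - c₁ = x - c₂ := by ring
    have e3 : x - (c₂ - c₁) - (c₁ + 1) = x - (c₂ + 1) := by ring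
    rw [e1, e2, e3]
  rw [heq]
  exact hmono (by linarith)

end Tent

/-! ### The spline `h` -/

/-- **The spline** `H(x) = κ(P₂(x; c₁) − P₂(x; c₂))`: `C²`, `H = 0` on `x ≤ c₁ − 1`,
`H'' = κ·tent(·; c₁) ≥ 0` on the growth zone, `H = κ(x − c₁)` linear on `[c₁ + 1, c₂ − 1]`,
`H'' = −κ·tent(·; c₂) ≤ 0` on the bend, `H = κ(c₂ − c₁)` beyond `c₂ + 1` — an explicit `h` with
the properties (evenmorechoices2) of DRSR arXiv:1402.7034 (growth, then linear growth), completed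
by a bend to a plateau. [cite: DafermosRodnianskiShlapentokhrothman2014, Prop. 8.7.3 (proof)] -/
def nsSpline (κ c₁ c₂ x : ℝ) : ℝ := κ * (unitTentPrim₂ c₁ x - unitTentPrim₂ c₂ x)

/-- `H' = κ(P₁(·; c₁) − P₁(·; c₂))`. [folklore] -/
def nsSpline₁ (κ c₁ c₂ x : ℝ) : ℝ := κ * (unitTentPrim c₁ x - unitTentPrim c₂ x)

/-- `H'' = κ(tent(·; c₁) − tent(·; c₂))`. [folklore] -/
def nsSpline₂ (κ c₁ c₂ x : ℝ) : ℝ := κ * (unitTent c₁ x - unitTent c₂ x)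

section Spline

variable {κ c₁ c₂ : ℝ}

/-- `H' ` is the derivative of `H`. [folklore] -/
theorem hasDerivAt_nsSpline (κ c₁ c₂ x : ℝ) :
    HasDerivAt (nsSpline κ c₁ c₂) (nsSpline₁ κ c₁ c₂ x) x :=
  ((hasDerivAt_unitTentPrim₂ c₁ x).sub (hasDerivAt_unitTentPrim₂ c₂ x)).const_mul κ

/-- `H'' ` is the derivative of `H'`. [folklore] -/
theorem hasDerivAt_nsSpline₁ (κ c₁ c₂ x : ℝ) :
    HasDerivAt (nsSpline₁ κ c₁ c₂) (nsSpline₂ κ c₁ c₂ x) x :=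
  ((hasDerivAt_unitTentPrim c₁ x).sub (hasDerivAt_unitTentPrim c₂ x)).const_mul κ

/-- Left of the growth zone (`x ≤ c₁ − 1`, `c₁ ≤ c₂`): `H = H' = H'' = 0`. [folklore] -/
theorem nsSpline_of_le (h : c₁ ≤ c₂) {x : ℝ} (hx : x ≤ c₁ - 1) :
    nsSpline κ c₁ c₂ x = 0 ∧ nsSpline₁ κ c₁ c₂ x = 0 ∧ nsSpline₂ κ c₁ c₂ x = 0 := by
  obtain ⟨a1, a2, a3⟩ := unitTent_of_le_left (c := c₁) hx
  obtain ⟨b1, b2, b3⟩ := unitTent_of_le_left (c := c₂) (show x ≤ c₂ - 1 by linarith)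
  simp [nsSpline, nsSpline₁, nsSpline₂, a1, a2, a3, b1, b2, b3]

/-- Beyond the bend (`x ≥ c₂ + 1`, `c₁ ≤ c₂`): `H = κ(c₂ − c₁)`, `H' = H'' = 0`. [folklore] -/
theorem nsSpline_of_ge (h : c₁ ≤ c₂) {x : ℝ} (hx : c₂ + 1 ≤ x) :
    nsSpline κ c₁ c₂ x = κ * (c₂ - c₁) ∧ nsSpline₁ κ c₁ c₂ x = 0 ∧ nsSpline₂ κ c₁ c₂ x = 0 := by
  obtain ⟨a1, a2, a3⟩ := unitTent_of_ge_right (c := c₁) (show c₁ + 1 ≤ x by linarith)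
  obtain ⟨b1, b2, b3⟩ := unitTent_of_ge_right (c := c₂) hx
  simp only [nsSpline, nsSpline₁, nsSpline₂, a1, a2, a3, b1, b2, b3]
  refine ⟨by ring, by ring, by ring⟩

/-- On the linear zone (`c₁ + 1 ≤ x ≤ c₂ − 1`): `H = κ(x − c₁)`, `H' = κ`, `H'' = 0`. [folklore] -/
theorem nsSpline_of_mem_linear {x : ℝ} (h1 : c₁ + 1 ≤ x) (h2 : x ≤ c₂ - 1) :
    nsSpline κ c₁ c₂ x = κ * (x - c₁) ∧ nsSpline₁ κ c₁ c₂ x = κ ∧ nsSpline₂ κ c₁ c₂ x = 0 := by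
  obtain ⟨a1, a2, a3⟩ := unitTent_of_ge_right (c := c₁) h1
  obtain ⟨b1, b2, b3⟩ := unitTent_of_le_left (c := c₂) h2
  simp only [nsSpline, nsSpline₁, nsSpline₂, a1, a2, a3, b1, b2, b3]
  refine ⟨by ring, by ring, by ring⟩

/-- On the growth zone (`x ≤ c₂ − 1`): `H'' = κ·tent(·; c₁) ∈ [0, κ]` (for `κ ≥ 0`). [folklore] -/
theorem nsSpline₂_of_le_bend (hκ : 0 ≤ κ) {x : ℝ} (hx : x ≤ c₂ - 1) :
    nsSpline₂ κ c₁ c₂ x = κ * unitTent c₁ x ∧ 0 ≤ nsSpline₂ κ c₁ c₂ x ∧ nsSpline₂ κ c₁ c₂ x ≤ κ := by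
  obtain ⟨b1, -, -⟩ := unitTent_of_le_left (c := c₂) hx
  have ht := unitTent_mem_Icc c₁ x
  have e : nsSpline₂ κ c₁ c₂ x = κ * unitTent c₁ x := by simp [nsSpline₂, b1]
  rw [e]
  exact ⟨rfl, mul_nonneg hκ ht.1, mul_le_of_le_one_right hκ ht.2⟩

/-- On and after the bend (`x ≥ c₁ + 1`): `H'' = −κ·tent(·; c₂) ≤ 0` (for `κ ≥ 0`). [folklore] -/
theorem nsSpline₂_of_ge_growth (hκ : 0 ≤ κ) {x : ℝ} (hx : c₁ + 1 ≤ x) :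
    nsSpline₂ κ c₁ c₂ x = -(κ * unitTent c₂ x) ∧ nsSpline₂ κ c₁ c₂ x ≤ 0 := by
  obtain ⟨a1, -, -⟩ := unitTent_of_ge_right (c := c₁) hx
  have ht := unitTent_mem_Icc c₂ x
  have e : nsSpline₂ κ c₁ c₂ x = -(κ * unitTent c₂ x) := by simp [nsSpline₂, a1]
  rw [e]
  exact ⟨rfl, by have := mul_nonneg hκ ht.1; linarith⟩

/-- `H' ≥ 0` (`κ ≥ 0`, `c₁ ≤ c₂`) and `H' ≤ κ`. [folklore] -/
theorem nsSpline₁_mem_Icc (hκ : 0 ≤ κ) (h : c₁ ≤ c₂) (x : ℝ) :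
    nsSpline₁ κ c₁ c₂ x ∈ Icc (0 : ℝ) κ := by
  unfold nsSpline₁
  have h1 := unitTentPrim_anti (x := x) h
  have h2 := unitTentPrim_mem_Icc c₁ x
  have h3 := unitTentPrim_mem_Icc c₂ x
  constructor
  · exact mul_nonneg hκ (by linarith)
  · nlinarith [h2.2, h3.1]

/-- `H` is non-decreasing (`κ ≥ 0`, `c₁ ≤ c₂`). [folklore] -/
theorem monotone_nsSpline (hκ : 0 ≤ κ) (h : c₁ ≤ c₂) : Monotone (nsSpline κ c₁ c₂) :=
  monotone_of_hasDerivAt_nonneg (fun x ↦ hasDerivAt_nsSpline κ c₁ c₂ x)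
    fun x ↦ (nsSpline₁_mem_Icc hκ h x).1

/-- `0 ≤ H ≤ κ(c₂ − c₁)` (`κ ≥ 0`, `c₁ + 2 ≤ c₂`). [folklore] -/
theorem nsSpline_mem_Icc (hκ : 0 ≤ κ) (h : c₁ + 2 ≤ c₂) (x : ℝ) :
    nsSpline κ c₁ c₂ x ∈ Icc (0 : ℝ) (κ * (c₂ - c₁)) := by
  have hm := monotone_nsSpline (κ := κ) hκ (by linarith : c₁ ≤ c₂)
  constructor
  · have h1 := hm (min_le_left x (c₁ - 1))
    rw [(nsSpline_of_le (κ := κ) (by linarith : c₁ ≤ c₂) (min_le_right x (c₁ - 1))).1] at h1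
    exact h1
  · have h1 := hm (le_max_left x (c₂ + 1))
    rw [(nsSpline_of_ge (κ := κ) (by linarith : c₁ ≤ c₂) (le_max_right x (c₂ + 1))).1] at h1
    exact h1

/-- Beyond the linear zone (`x ≥ c₂ − 1`): `H(x) ≥ κ(c₂ − 1 − c₁)` (monotonicity; on the linear
zone itself `H = κ(x − c₁)` by `nsSpline_of_mem_linear`). [folklore] -/
theorem nsSpline_ge_of_ge_bend (hκ : 0 ≤ κ) (h : c₁ + 2 ≤ c₂) {x : ℝ} (hx : c₂ - 1 ≤ x) :
    κ * (c₂ - 1 - c₁) ≤ nsSpline κ c₁ c₂ x := by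
  have hm := monotone_nsSpline (κ := κ) hκ (by linarith : c₁ ≤ c₂) hx
  rw [(nsSpline_of_mem_linear (κ := κ) (by linarith : c₁ + 1 ≤ c₂ - 1) le_rfl).1] at hm
  exact hm

end Spline

/-! ### The weight `ỹ = −exp(−C(R − r₊))` -/

/-- **The weight `ỹ(r*) = −exp(−C(R(r*) − r₊))`** of DRSR arXiv:1402.7034, §8.7.3, with the
choice `υ = dR/dr* = Δ(R)/(R² + a²)` in `ỹ = −exp(−C∫υ dr*)` (so that the integral is `R − r₊`
exactly; `υ` is `≍ Δ` near `r₊` and `→ 1` at infinity, as required in (propertiesofp)).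
[cite: DafermosRodnianskiShlapentokhrothman2014, Prop. 8.7.3 (proof)] -/
def nsWeightY (M a C : ℝ) (R : ℝ → ℝ) (x : ℝ) : ℝ :=
  -Real.exp (-(C * (R x - rPlus M a)))

/-- `ỹ' = C·(Δ(R)/(R² + a²))·exp(−C(R − r₊)) = Cυ|ỹ|`. [cite: DafermosRodnianskiShlapentokhrothman2014, Prop. 8.7.3 (proof)] -/
def nsWeightYDeriv (M a C : ℝ) (R : ℝ → ℝ) (x : ℝ) : ℝ :=
  C * (delta M a (R x) / (R x ^ 2 + a ^ 2)) * Real.exp (-(C * (R x - rPlus M a)))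

section WeightY

variable {M a C : ℝ} {R : ℝ → ℝ}

/-- `ỹ' ` is the derivative of `ỹ`. [folklore] -/
theorem hasDerivAt_nsWeightY (hR : IsTortoiseRadius M a R) (C x : ℝ) :
    HasDerivAt (nsWeightY M a C R) (nsWeightYDeriv M a C R x) x := by
  have h1 : HasDerivAt (fun t ↦ -(C * (R t - rPlus M a)))
      (-(C * (delta M a (R x) / (R x ^ 2 + a ^ 2)))) x :=
    (((hR.hasDerivAt x).sub_const (rPlus M a)).const_mul C).neg
  have h2 := h1.exp.neg
  unfold nsWeightY nsWeightYDeriv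
  refine h2.congr_deriv ?_
  ring

/-- `−1 < ỹ < 0` on `ℝ` for `C > 0` (and `ỹ ≥ −1` for `C ≥ 0`); precisely `ỹ ∈ [−1, 0)`.
[folklore] -/
theorem nsWeightY_mem (hR : IsTortoiseRadius M a R) (hC : 0 ≤ C) (x : ℝ) :
    -1 ≤ nsWeightY M a C R x ∧ nsWeightY M a C R x < 0 := by
  unfold nsWeightY
  have h1 : Real.exp (-(C * (R x - rPlus M a))) ≤ 1 := by
    rw [Real.exp_le_one_iff]
    have := (hR.rPlus_lt x).le
    nlinarith
  exact ⟨by linarith, by linarith [Real.exp_pos (-(C * (R x - rPlus M a)))]⟩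

/-- `ỹ' > 0` for `C > 0` (`|a| < M`). [folklore] -/
theorem nsWeightYDeriv_pos (hR : IsTortoiseRadius M a R) (hMa : IsSubextremal M a) (hC : 0 < C)
    (x : ℝ) : 0 < nsWeightYDeriv M a C R x := by
  unfold nsWeightYDeriv
  exact mul_pos (mul_pos hC (hR.deriv_pos hMa x)) (Real.exp_pos _)

/-- `ỹ' = Cυ|ỹ|` with `υ = Δ(R)/(R² + a²)`. [folklore] -/
theorem nsWeightYDeriv_eq (x : ℝ) :
    nsWeightYDeriv M a C R x =
      C * (delta M a (R x) / (R x ^ 2 + a ^ 2)) * (-nsWeightY M a C R x) := by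
  unfold nsWeightYDeriv nsWeightY
  ring

/-- `ỹ → −1` at the horizon end. [cite: DafermosRodnianskiShlapentokhrothman2014, Prop. 8.7.3 (proof)] -/
theorem tendsto_nsWeightY_atBot (hR : IsTortoiseRadius M a R) (C : ℝ) :
    Tendsto (nsWeightY M a C R) atBot (𝓝 (-1)) := by
  have h1 : Tendsto (fun x ↦ -(C * (R x - rPlus M a))) atBot (𝓝 (-(C * (rPlus M a - rPlus M a)))) :=
    ((hR.tendsto_atBot.sub_const (rPlus M a)).const_mul C).neg
  rw [sub_self, mul_zero, neg_zero] at h1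
  have h2 := (Real.continuous_exp.tendsto 0).comp h1
  rw [Function.comp_def, Real.exp_zero] at h2
  exact h2.neg

/-- `ỹ → 0` at infinity (`C > 0`). [cite: DafermosRodnianskiShlapentokhrothman2014, Prop. 8.7.3 (proof)] -/
theorem tendsto_nsWeightY_atTop (hR : IsTortoiseRadius M a R) (hC : 0 < C) :
    Tendsto (nsWeightY M a C R) atTop (𝓝 0) := by
  have h1 : Tendsto (fun x ↦ -(C * (R x - rPlus M a))) atTop atBot := by
    have h := (hR.tendsto_atTop.atTop_add (tendsto_const_nhds (x := -rPlus M a))).const_mul_atTop hC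
    have h' : Tendsto (fun x ↦ C * (R x - rPlus M a)) atTop atTop := by
      simpa [sub_eq_add_neg] using h
    exact tendsto_neg_atTop_atBot.comp h'
  have h2 := Real.tendsto_exp_atBot.comp h1
  have h3 := h2.neg
  rw [neg_zero] at h3
  exact h3

/-- **Lower bound for `ỹ'` on a radial range**: if `R(x) ≤ ρ` and `Δ(R)/(R² + a²) ≥ q₀` then
`ỹ'(x) ≥ C q₀ exp(−C(ρ − r₊))` (`C ≥ 0`). [folklore] -/
theorem nsWeightYDeriv_ge (hC : 0 ≤ C) {x ρ q₀ : ℝ} (hq₀ : 0 ≤ q₀)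
    (hq : q₀ ≤ delta M a (R x) / (R x ^ 2 + a ^ 2)) (hρ : R x ≤ ρ) :
    C * q₀ * Real.exp (-(C * (ρ - rPlus M a))) ≤ nsWeightYDeriv M a C R x := by
  unfold nsWeightYDeriv
  have h1 : Real.exp (-(C * (ρ - rPlus M a))) ≤ Real.exp (-(C * (R x - rPlus M a))) := by
    rw [Real.exp_le_exp]; nlinarith
  exact mul_le_mul (mul_le_mul_of_nonneg_left hq hC) h1 (Real.exp_pos _).le
    (mul_nonneg hC (hq₀.trans hq))

/-- Upper bound: `ỹ' ≤ C` (`υ ≤ 1`, `|ỹ| ≤ 1`; `C ≥ 0`, `|a| < M`). [folklore] -/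
theorem nsWeightYDeriv_le (hR : IsTortoiseRadius M a R) (hMa : IsSubextremal M a) (hC : 0 ≤ C)
    (x : ℝ) : nsWeightYDeriv M a C R x ≤ C := by
  unfold nsWeightYDeriv
  have h1 : Real.exp (-(C * (R x - rPlus M a))) ≤ 1 := by
    rw [Real.exp_le_one_iff]
    have := (hR.rPlus_lt x).le
    nlinarith
  have h2 := hR.deriv_le_one hMa x
  have h3 := (hR.deriv_pos hMa x).le
  calc C * (delta M a (R x) / (R x ^ 2 + a ^ 2)) * Real.exp (-(C * (R x - rPlus M a)))
      ≤ C * 1 * 1 := mul_le_mul (mul_le_mul_of_nonneg_left h2 hC) h1 (Real.exp_pos _).le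
        (by positivity)
    _ = C := by ring

end WeightY

end Kerr

end Literature.Geometry.Lorentzian
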